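import Summits.NavierStokesRegularity.NavierStokesRegularity.Theorems.AdaptedKernelExists.Negative.GalileanCalibration

/-!
# `AdaptedKernelExists` (stmt-NavierStokesRegularity-2956): tightness and refuted strengthenings on the Galilean family

Negative lemmas for the crux `AdaptedFrequency.AdaptedKernelExists`, extracted from the crux work
file `Cruxes/AdaptedKernelExists/Disproof.lean` (cdisprove seat, cycle 1), §3.1 (second half). No
conclusion asserts a route item.

On the Galilean kernel of `GalileanCalibration`: TIGHTNESS of the lower constant,
`c₁ ≤ (4πν)^{-3/2} e^{-C²‖e‖²/ν}` for every admissible lower Gaussian bound on a window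
(`gal_lower_const_le`) — the `e^{-O(C²/ν)}` loss budgeted by the lines is sharp; and three
REFUTED natural strengthenings of the linear transfer target: no rate-free lower constant
(`gal_no_rate_free_lower_const`), no pure-Gaussian upper bound with the free variance `4ν(T - t)`
once `C ≠ 0` (`gal_not_upper_freeVariance`: `C₂ > 4ν` forced), and no lower bound with the free
variance either (`gal_not_lower_freeVariance`: `c₂ < 4ν` forced). [folklore]
-/

noncomputable section

namespace Summit.NavierStokesRegularity.NavierStokesRegularity.Theorems.AdaptedKernelExistsNegative.GalileanTight

open Set Filter Topology MeasureTheory Function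
open scoped Laplacian InnerProductSpace RealInnerProductSpace ContDiff
open Literature.Analysis.FluidPDE Literature.Analysis

local notation "ℝ³" => EuclideanSpace ℝ (Fin 3)

open UniformDrift Galilean

variable {ν T C : ℝ} {x₀ e : ℝ³}

/-- **TIGHTNESS of the lower constant.** Any admissible lower Gaussian constant `c₁` for the
Galilean kernel on a window `[t₀, T)` satisfies `c₁ ≤ (4πν)^{-3/2} e^{-C²‖e‖²/ν}`: the
`e^{-O(C²/ν)}` loss budgeted by all three lines is SHARP on this family (test at the pole). -/
theorem gal_lower_const_le (hν : 0 < ν) {t₀ : ℝ} (ht₀ : t₀ < T) {c₁ c₂ : ℝ}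
    (h : ∀ t ∈ Ico t₀ T, ∀ x, c₁ * (T - t) ^ (-(3 : ℝ) / 2) *
      Real.exp (-(‖x - x₀‖ ^ 2) / (c₂ * (T - t))) ≤ galKernel ν T x₀ e C t x) :
    c₁ ≤ (4 * Real.pi * ν) ^ (-(3 : ℝ) / 2) * Real.exp (-(C ^ 2 * ‖e‖ ^ 2 / ν)) := by
  have hs : 0 < T - t₀ := sub_pos.2 ht₀
  have hspow : 0 < (T - t₀) ^ (-(3 : ℝ) / 2) := Real.rpow_pos_of_pos hs _
  have h1 := h t₀ ⟨le_rfl, ht₀⟩ x₀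
  rw [galKernel_pole hν ht₀] at h1
  simp only [sub_self, norm_zero, ne_eq, OfNat.ofNat_ne_zero, not_false_eq_true, zero_pow, neg_zero,
    zero_div, Real.exp_zero, mul_one] at h1
  -- cancel the common positive factor `(T - t₀)^{-3/2}`
  have h2 : c₁ * (T - t₀) ^ (-(3 : ℝ) / 2) ≤
      ((4 * Real.pi * ν) ^ (-(3 : ℝ) / 2) * Real.exp (-(C ^ 2 * ‖e‖ ^ 2 / ν))) *
        (T - t₀) ^ (-(3 : ℝ) / 2) := by
    calc _ ≤ _ := h1
      _ = _ := by ring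
  exact le_of_mul_le_mul_right h2 hspow

/-- **No rate-free lower constant.** A natural strengthening of `C⁺` is FALSE: there is no lower
constant `c₁ > 0` serving every Type-I constant `C` (with any width `c₂ = c₂(C)`), since the
pole value decays like `e^{-C²‖e‖²/ν}` — the constants of `C⁺` must depend on `C`. -/
theorem gal_no_rate_free_lower_const (hν : 0 < ν) (he : e ≠ 0) {t₀ : ℝ} (ht₀ : t₀ < T) :
    ¬ ∃ c₁ : ℝ, 0 < c₁ ∧ ∀ C : ℝ, ∃ c₂ : ℝ, ∀ t ∈ Ico t₀ T, ∀ x,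
      c₁ * (T - t) ^ (-(3 : ℝ) / 2) * Real.exp (-(‖x - x₀‖ ^ 2) / (c₂ * (T - t))) ≤
        galKernel ν T x₀ e C t x := by
  rintro ⟨c₁, hc₁, h⟩
  -- the pole value tends to `0` as `C → ∞`
  have hlim : Tendsto (fun C : ℝ => (4 * Real.pi * ν) ^ (-(3 : ℝ) / 2) *
      Real.exp (-(C ^ 2 * ‖e‖ ^ 2 / ν))) atTop (𝓝 0) := by
    have he2 : 0 < ‖e‖ ^ 2 / ν := div_pos (pow_pos (norm_pos_iff.2 he) 2) hν
    have h1 : Tendsto (fun C : ℝ => C ^ 2 * (‖e‖ ^ 2 / ν)) atTop atTop :=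
      (tendsto_pow_atTop two_ne_zero).atTop_mul_const he2
    have h2 : Tendsto (fun C : ℝ => Real.exp (-(C ^ 2 * ‖e‖ ^ 2 / ν))) atTop (𝓝 0) := by
      have := Real.tendsto_exp_atBot.comp (tendsto_neg_atTop_atBot.comp h1)
      refine this.congr fun C => ?_
      simp only [Function.comp_apply]
      ring_nf
    simpa using h2.const_mul ((4 * Real.pi * ν) ^ (-(3 : ℝ) / 2))
  obtain ⟨C, hC⟩ := (hlim.eventually (gt_mem_nhds hc₁)).exists
  obtain ⟨c₂, hc₂⟩ := h C
  exact absurd (gal_lower_const_le hν ht₀ hc₂) (not_le.2 hC)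

/-- **The free variance cannot be kept in the upper bound.** For `C ≠ 0`, `e ≠ 0` there is NO
constant `C₁` with `Γ(t₀, x) ≤ C₁ (T - t₀)^{-3/2} e^{-‖x - x₀‖²/(4ν(T - t₀))}` for all `x` — not even
at a single time: behind the moving pole (`x = x₀ - λ·2C√(T - t₀) e`, `λ → ∞`) the ratio is
`e^{(2λ - 1)C²‖e‖²/ν}`. So every proof's `C₂` must EXCEED the free `4ν` once the drift is
non-zero (the lines have `8ν`, `48ν`: consistent); Carlen–Loss's displacement form
`exp(-(‖z‖ - ∫‖b‖)₊²/(4νs))` is the sharp shape. -/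
theorem gal_not_upper_freeVariance (hν : 0 < ν) (hC : C ≠ 0) (he : e ≠ 0) {t₀ : ℝ} (ht₀ : t₀ < T) :
    ¬ ∃ C₁ : ℝ, ∀ x, galKernel ν T x₀ e C t₀ x ≤
      C₁ * (T - t₀) ^ (-(3 : ℝ) / 2) * Real.exp (-(‖x - x₀‖ ^ 2) / (4 * ν * (T - t₀))) := by
  rintro ⟨C₁, h⟩
  have hs : 0 < T - t₀ := sub_pos.2 ht₀
  set s := T - t₀ with hsdef
  set d := galDisp C T t₀ with hd
  set A : ℝ := (4 * Real.pi * ν) ^ (-(3 : ℝ) / 2) with hA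
  have hApos : 0 < A := Real.rpow_pos_of_pos (by positivity) _
  have hspow : 0 < s ^ (-(3 : ℝ) / 2) := Real.rpow_pos_of_pos hs _
  set k : ℝ := C ^ 2 * ‖e‖ ^ 2 / ν with hk
  have hkpos : 0 < k := div_pos (mul_pos (pow_pos (abs_pos.2 hC) 2 |>.trans_eq (sq_abs C))
    (pow_pos (norm_pos_iff.2 he) 2)) hν
  have hd2 : d ^ 2 * ‖e‖ ^ 2 = 4 * ν * s * k := by
    rw [hd, galDisp, mul_pow, mul_pow, Real.sq_sqrt hs.le, hk]
    field_simp
    ring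
  -- test points behind the pole
  have key : ∀ lam : ℝ, A * Real.exp ((2 * lam - 1) * k) ≤ C₁ := by
    intro lam
    have h1 := h (x₀ - (lam * d) • e)
    rw [galKernel, recentredKernel_closed_form hν.le x₀ e _ ht₀] at h1
    have hn1 : ‖x₀ - (lam * d) • e - x₀ + galDisp C T t₀ • e‖ ^ 2 = (1 - lam) ^ 2 * (d ^ 2 * ‖e‖ ^ 2) := by
      rw [show x₀ - (lam * d) • e - x₀ + galDisp C T t₀ • e = ((1 - lam) * d) • e by
        rw [← hd]; module]
      rw [norm_smul, mul_pow, Real.norm_eq_abs, sq_abs]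
      ring
    have hn2 : ‖x₀ - (lam * d) • e - x₀‖ ^ 2 = lam ^ 2 * (d ^ 2 * ‖e‖ ^ 2) := by
      rw [show x₀ - (lam * d) • e - x₀ = (-(lam * d)) • e by module]
      rw [norm_smul, mul_pow, Real.norm_eq_abs, sq_abs]
      ring
    rw [hn1, hn2, hd2] at h1
    have he1 : -((1 - lam) ^ 2 * (4 * ν * s * k)) / (4 * ν * s) = -((1 - lam) ^ 2 * k) := by
      field_simp
    have he2 : -(lam ^ 2 * (4 * ν * s * k)) / (4 * ν * s) = -(lam ^ 2 * k) := by
      field_simp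
    rw [he1, he2] at h1
    -- h1 : A * s^{-3/2} * exp(-(1-lam)² k) ≤ C₁ * s^{-3/2} * exp(-lam² k)
    have h2 : A * Real.exp (-((1 - lam) ^ 2 * k)) ≤ C₁ * Real.exp (-(lam ^ 2 * k)) := by
      have h3 : (A * Real.exp (-((1 - lam) ^ 2 * k))) * s ^ (-(3 : ℝ) / 2) ≤
          (C₁ * Real.exp (-(lam ^ 2 * k))) * s ^ (-(3 : ℝ) / 2) := by
        calc _ = A * s ^ (-(3 : ℝ) / 2) * Real.exp (-((1 - lam) ^ 2 * k)) := by ring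
          _ ≤ _ := h1
          _ = _ := by ring
      exact le_of_mul_le_mul_right h3 hspow
    have h4 := mul_le_mul_of_nonneg_right h2 (Real.exp_pos (lam ^ 2 * k)).le
    rw [mul_assoc, ← Real.exp_add, mul_assoc, ← Real.exp_add] at h4
    rw [show -(lam ^ 2 * k) + lam ^ 2 * k = 0 by ring, Real.exp_zero, mul_one,
      show -((1 - lam) ^ 2 * k) + lam ^ 2 * k = (2 * lam - 1) * k by ring] at h4
    exact h4
  -- but the left-hand side is unbounded in `lam`
  have hlim : Tendsto (fun lam : ℝ => A * Real.exp ((2 * lam - 1) * k)) atTop atTop := by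
    have h1 : Tendsto (fun lam : ℝ => (2 * lam - 1) * k) atTop atTop := by
      have : Tendsto (fun lam : ℝ => 2 * lam - 1) atTop atTop :=
        tendsto_atTop_add_const_right _ (-1) (tendsto_id.const_mul_atTop two_pos)
      exact this.atTop_mul_const hkpos
    exact (Real.tendsto_exp_atTop.comp h1).const_mul_atTop hApos
  obtain ⟨lam, hlam⟩ := (hlim.eventually (eventually_gt_atTop C₁)).exists
  exact absurd (key lam) (not_le.2 hlam)

/-- **Nor can the free variance be kept in the LOWER bound.** For `C ≠ 0`, `e ≠ 0` there is no
`c₁ > 0` with `c₁ (T - t₀)^{-3/2} e^{-‖x - x₀‖²/(4ν(T - t₀))} ≤ Γ(t₀, x)` for all `x`: ahead of the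
pole (`x = x₀ + λ·2C√(T - t₀) e`) the ratio is `e^{-(1 + 2λ)C²‖e‖²/ν} → 0`. So every proof's `c₂`
must be STRICTLY below `4ν` (the lines have `2ν/3`, `2ν`: consistent): the comparability cone of
a drifted kernel is strictly wider than the heat kernel's on both sides. -/
theorem gal_not_lower_freeVariance (hν : 0 < ν) (hC : C ≠ 0) (he : e ≠ 0) {t₀ : ℝ} (ht₀ : t₀ < T) :
    ¬ ∃ c₁ : ℝ, 0 < c₁ ∧ ∀ x, c₁ * (T - t₀) ^ (-(3 : ℝ) / 2) *
      Real.exp (-(‖x - x₀‖ ^ 2) / (4 * ν * (T - t₀))) ≤ galKernel ν T x₀ e C t₀ x := by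
  rintro ⟨c₁, hc₁, h⟩
  have hs : 0 < T - t₀ := sub_pos.2 ht₀
  set s := T - t₀ with hsdef
  set d := galDisp C T t₀ with hd
  set A : ℝ := (4 * Real.pi * ν) ^ (-(3 : ℝ) / 2) with hA
  have hspow : 0 < s ^ (-(3 : ℝ) / 2) := Real.rpow_pos_of_pos hs _
  set k : ℝ := C ^ 2 * ‖e‖ ^ 2 / ν with hk
  have hkpos : 0 < k := div_pos (mul_pos (pow_pos (abs_pos.2 hC) 2 |>.trans_eq (sq_abs C))
    (pow_pos (norm_pos_iff.2 he) 2)) hν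
  have hd2 : d ^ 2 * ‖e‖ ^ 2 = 4 * ν * s * k := by
    rw [hd, galDisp, mul_pow, mul_pow, Real.sq_sqrt hs.le, hk]
    field_simp
    ring
  -- test points ahead of the pole
  have key : ∀ lam : ℝ, c₁ ≤ A * Real.exp (-((1 + 2 * lam) * k)) := by
    intro lam
    have h1 := h (x₀ + (lam * d) • e)
    rw [galKernel, recentredKernel_closed_form hν.le x₀ e _ ht₀] at h1
    have hn1 : ‖x₀ + (lam * d) • e - x₀ + galDisp C T t₀ • e‖ ^ 2 = (1 + lam) ^ 2 * (d ^ 2 * ‖e‖ ^ 2) := by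
      rw [show x₀ + (lam * d) • e - x₀ + galDisp C T t₀ • e = ((1 + lam) * d) • e by
        rw [← hd]; module]
      rw [norm_smul, mul_pow, Real.norm_eq_abs, sq_abs]
      ring
    have hn2 : ‖x₀ + (lam * d) • e - x₀‖ ^ 2 = lam ^ 2 * (d ^ 2 * ‖e‖ ^ 2) := by
      rw [show x₀ + (lam * d) • e - x₀ = (lam * d) • e by module]
      rw [norm_smul, mul_pow, Real.norm_eq_abs, sq_abs]
      ring
    rw [hn1, hn2, hd2] at h1
    have he1 : -((1 + lam) ^ 2 * (4 * ν * s * k)) / (4 * ν * s) = -((1 + lam) ^ 2 * k) := by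
      field_simp
    have he2 : -(lam ^ 2 * (4 * ν * s * k)) / (4 * ν * s) = -(lam ^ 2 * k) := by
      field_simp
    rw [he1, he2] at h1
    -- h1 : c₁ * s^{-3/2} * exp(-lam² k) ≤ A * s^{-3/2} * exp(-(1+lam)² k)
    have h2 : c₁ * Real.exp (-(lam ^ 2 * k)) ≤ A * Real.exp (-((1 + lam) ^ 2 * k)) := by
      have h3 : (c₁ * Real.exp (-(lam ^ 2 * k))) * s ^ (-(3 : ℝ) / 2) ≤
          (A * Real.exp (-((1 + lam) ^ 2 * k))) * s ^ (-(3 : ℝ) / 2) := by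
        calc _ = c₁ * s ^ (-(3 : ℝ) / 2) * Real.exp (-(lam ^ 2 * k)) := by ring
          _ ≤ _ := h1
          _ = _ := by ring
      exact le_of_mul_le_mul_right h3 hspow
    have h4 := mul_le_mul_of_nonneg_right h2 (Real.exp_pos (lam ^ 2 * k)).le
    rw [mul_assoc, ← Real.exp_add, mul_assoc, ← Real.exp_add] at h4
    rw [show -(lam ^ 2 * k) + lam ^ 2 * k = 0 by ring, Real.exp_zero, mul_one,
      show -((1 + lam) ^ 2 * k) + lam ^ 2 * k = -((1 + 2 * lam) * k) by ring] at h4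
    exact h4
  -- but the right-hand side tends to `0`
  have hlim : Tendsto (fun lam : ℝ => A * Real.exp (-((1 + 2 * lam) * k))) atTop (𝓝 0) := by
    have h1 : Tendsto (fun lam : ℝ => (1 + 2 * lam) * k) atTop atTop := by
      have : Tendsto (fun lam : ℝ => 1 + 2 * lam) atTop atTop :=
        tendsto_atTop_add_const_left _ 1 (tendsto_id.const_mul_atTop two_pos)
      exact this.atTop_mul_const hkpos
    have h2 := Real.tendsto_exp_atBot.comp (tendsto_neg_atTop_atBot.comp h1)
    simpa using h2.const_mul A
  obtain ⟨lam, hlam⟩ := (hlim.eventually (gt_mem_nhds hc₁)).exists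
  exact absurd (key lam) (not_le.2 hlam)


end Summit.NavierStokesRegularity.NavierStokesRegularity.Theorems.AdaptedKernelExistsNegative.GalileanTight

end
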